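import Literature.AlgebraicGeometry.Resolution.PlaneNearPointLemmas
import HarnessLib

/-!
# Near points of the plane, II: Hironaka's Theorem 2 for `ℙ²` — a near point lies on a rational line

Topic: `Literature/AlgebraicGeometry/Resolution`. [CoP1] = Cossart–Piltant, J. Algebra 320 (2008),
proof of Prop. 4.2 ("Near and very near points", p. 8), for the blowing up of a CLOSED POINT `x`
of a regular threefold (`r = 3`, fibre `q⁻¹(x) ≅ ℙ²_{k(x)}`):

> "By Hironaka's theorem 2 [25], `x′ ∈ Proj(Dir_x(E)) ⊆ Proj(k(x)[Y_1, …, Y_r])` if `x′` is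
> very near to `x`. This holds if `k` is perfect or if `char(k) ≥ dim(C_x(E))` which is the
> case here, since `dim R = 3`."

On the chart `Y_j ≠ 0` of `ℙ²` (affine plane `Spec k[T_1, T_2]`, `k = k(x)` ARBITRARY), a point
`x′` is a prime `𝔮`, and nearness of `x′` says that for every initial form `F ∈ cl_μ(J)` the
dehomogenization `g = F(T_j := 1)` (a polynomial of degree `≤ μ`) has `ord_𝔮 g ≥ μ`, i.e.
`s g ∈ 𝔮^μ` for some `s ∉ 𝔮` (`NearPointsRational.algebraMap_eval₂Hom_mem_pow_of_isNear`,
`RegularCentreBlowupOrder.exists_chartResidueMap`). THE THEOREM PROVED HERE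
(`mem_affineLinearIn_pow_of_mul_mem_pow`): **such a `g` is a `k`-linear combination of products
of `μ` affine-linear polynomials lying in `𝔮`** (`g ∈ U′(𝔮)^μ`). Homogenizing, every
`F ∈ cl_μ(J)` is a polynomial in the linear forms vanishing at `x′`, so the directrix `T_x`
consists of forms vanishing at `x′`: `x′ ∈ Proj(Dir_x(E))` — for every residue field, in every
characteristic (the sequel `PlaneNearForms.lean` draws [CoP1] Lemma 4.3 (1), (3), (5) from it).

## The proof (ours; elementary)

By `eq_bot_or_eq_span_or_isMaximal`, `𝔮` is `0` (then `g = 0` for `μ ≥ 1`), or `(π)` with `π`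
prime (then `π^μ ∣ g`, and `deg g ≤ μ` forces `π` affine-linear and `g = c π^μ`), or MAXIMAL.
In the last case `K = A/𝔮` is algebraic over `k` (Nullstellensatz); let `t_i` be the image of
`T_i`, `π = minpoly_k(t_2)`, `k′ = k(t_2) ⊆ K`. Induction on `μ` (for fixed `𝔮` and `s`):
* if `t_1 ∈ k′`, say `t_1 = h(t_2)` with `deg h < deg π`
  (`mem_affineLinearIn_pow_succ_of_aeval_eq`): with `ev″ : T_1 ↦ h(X), T_2 ↦ X` one has
  `ρ = (X ↦ t_2) ∘ ev″`, `ker ev″ = (ℓ̃)`, `ℓ̃ = T_1 − h(T_2)`, `𝔮 = (ℓ̃, π(T_2))`; `π^μ` divides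
  `ev″ g`, whose degree is `≤ max(1, deg π − 1) · deg g`, so `ev″ g = c π^μ` with `c = 0` unless
  `deg π = 1`; hence `g = c π(T_2)^μ + ℓ̃ g₂`, and CANCELLATION (`mem_span_pair_pow_of_mul_mem`)
  gives `s g₂ ∈ 𝔮^{μ-1}`; degrees are additive, so `deg g₂ ≤ μ − 1` and the induction hypothesis
  applies; the ORDER BOUND `ord ≤ deg` (`le_totalDegree_of_mul_mem_pow`) gives `deg g₂ ≥ μ − 1`,
  whence `deg ℓ̃ ≤ 1`, i.e. `ℓ̃ ∈ U′(𝔮)`, and `g ∈ U′(𝔮)^μ`;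
* if `t_1 ∉ k′` (`mem_affineLinearIn_pow_succ_of_two_le`): with `ev′ : T_1 ↦ X, T_2 ↦ t_2`
  (onto `k′[X]`, kernel `(π(T_2))`) and `ψ = minpoly_{k′}(t_1)` of degree `≥ 2`, `ψ^μ` divides
  `ev′ g` of degree `≤ μ`, so `ev′ g = 0`, `g = π(T_2) g₁`, `𝔮 = (π(T_2), b)` for a lift `b` of
  `ψ`; cancellation, additivity of degrees, induction and the order bound give `deg π(T_2) ≤ 1`
  and `g ∈ U′(𝔮)^μ`. (The passage through `k′` and `ψ` is where the inseparable multiplicity is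
  seen: for `𝔮 = (T_1^p − a, T_2^p − b)` over `𝔽_p(a, b)` no near `g` exists.)

## Sources

* V. Cossart, O. Piltant, J. Algebra 320 (2008) 1051–1082, proof of Prop. 4.2 (p. 8) and
  Lemma 4.3. [CossartPiltant2008]
* H. Hironaka, *Additive groups associated with points of a projective space*, Ann. of Math. 92
  (1970) 327–334, Thm. 2 (cited as [25] in [CoP1]); H. Hironaka, *Idealistic exponents of
  singularity* (1977), Cor. 3.2 ([26] in [CoP1]). The proof given here is not Hironaka's.
-/

open MvPolynomial Polynomial

noncomputable section

namespace Literature.AlgebraicGeometry.Resolution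

universe u

variable {k : Type u} [Field k]

/-! ## The closed point case: `𝔮 = ker ρ` for `ρ : k[T_1, T_2] → K` onto an algebraic extension -/

section ClosedPoint

variable {K : Type*} [Field K] [Algebra k K] (ρ : MvPolynomial (Fin 2) k →ₐ[k] K)

/-- Images of `(ker ρ)^n` under a substitution `ev` with `ψ ∣ ev(ker ρ)` are divisible by `ψ^n`.
[folklore] -/
theorem pow_dvd_of_mem_ker_pow {B : Type*} [CommRing B] [Algebra k B]
    (ev : MvPolynomial (Fin 2) k →ₐ[k] B) (ψ : B) (hdvd : ∀ p ∈ RingHom.ker ρ, ψ ∣ ev p) {n : ℕ}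
    {p : MvPolynomial (Fin 2) k} (hp : p ∈ RingHom.ker ρ ^ n) : ψ ^ n ∣ ev p := by
  have hle : (RingHom.ker ρ).map ev ≤ Ideal.span {ψ} := by
    rw [Ideal.map_le_iff_le_comap]
    intro q hq
    rw [Ideal.mem_comap, Ideal.mem_span_singleton]
    exact hdvd q hq
  have hle' : (RingHom.ker ρ ^ n).map ev ≤ Ideal.span {ψ ^ n} := by
    rw [Ideal.map_pow, ← Ideal.span_singleton_pow]
    exact Ideal.pow_right_mono hle n
  exact Ideal.mem_span_singleton.mp (hle' (Ideal.mem_map_of_mem _ hp))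

/-- `ρ(π(T_i)) = π(t_i)`. [folklore] -/
theorem apply_toMvPolynomial (π : Polynomial k) (i : Fin 2) :
    ρ (π.toMvPolynomial i) = Polynomial.aeval (ρ (X i)) π := by
  conv_lhs => rw [MvPolynomial.aeval_unique ρ]
  rw [MvPolynomial.aeval_toMvPolynomial]
  rfl

/-- In `k(t)` (`t` algebraic) every element is `h(t)` with `deg h < deg minpoly(t)`. [folklore] -/
theorem exists_aeval_eq_of_mem_adjoin_simple {t y : K} (ht : IsIntegral k t)
    (hy : y ∈ IntermediateField.adjoin k {t}) :
    ∃ h : Polynomial k, Polynomial.aeval t h = y ∧ h.natDegree < (minpoly k t).natDegree := by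
  have hy' : y ∈ (IntermediateField.adjoin k {t}).toSubalgebra := hy
  rw [IntermediateField.adjoin_simple_toSubalgebra_of_isAlgebraic ht.isAlgebraic,
    Algebra.adjoin_singleton_eq_range_aeval] at hy'
  obtain ⟨h₀, hh₀⟩ := (AlgHom.mem_range _).mp hy'
  refine ⟨h₀ %ₘ minpoly k t, ?_,
    Polynomial.natDegree_modByMonic_lt h₀ (minpoly.monic ht) (minpoly.ne_one k t)⟩
  rw [Polynomial.aeval_modByMonic_eq_self_of_root (minpoly.aeval k t), hh₀]

/-- `k[X] → k(t)`, `X ↦ t`, is onto for `t` algebraic. [folklore] -/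
theorem aeval_gen_surjective {t : K} (ht : IsIntegral k t) :
    Function.Surjective (Polynomial.aeval (IntermediateField.AdjoinSimple.gen k t) :
      Polynomial k →ₐ[k] IntermediateField.adjoin k {t}) := by
  intro y
  obtain ⟨h, hh, -⟩ := exists_aeval_eq_of_mem_adjoin_simple ht y.2
  refine ⟨h, Subtype.ext ?_⟩
  rw [IntermediateField.AdjoinSimple.coe_aeval_gen_apply]
  exact hh

/-- **Inductive step, case `t_1 ∈ k(t_2)`** (`t_i = ρ(T_i)`, `t_1 = h(t_2)`): see the module
docstring. [cite: CossartPiltant2008, Lemma 4.3; Hironaka1970, Thm. 2] -/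
theorem mem_affineLinearIn_pow_succ_of_aeval_eq (hint : ∀ i, IsIntegral k (ρ (X i)))
    {h : Polynomial k} (hh : Polynomial.aeval (ρ (X 1)) h = ρ (X 0))
    (hhdeg : h.natDegree < (minpoly k (ρ (X 1))).natDegree)
    {s : MvPolynomial (Fin 2) k} (hs : s ∉ RingHom.ker ρ) {n : ℕ}
    (ih : ∀ g : MvPolynomial (Fin 2) k, g.totalDegree ≤ n → s * g ∈ RingHom.ker ρ ^ n →
      g ∈ affineLinearIn (RingHom.ker ρ) ^ n)
    {g : MvPolynomial (Fin 2) k} (hdeg : g.totalDegree ≤ n + 1)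
    (hsg : s * g ∈ RingHom.ker ρ ^ (n + 1)) :
    g ∈ affineLinearIn (RingHom.ker ρ) ^ (n + 1) := by
  classical
  haveI : (RingHom.ker ρ).IsPrime := RingHom.ker_isPrime ρ
  -- `π`, the minimal polynomial of `t_2`, `d = deg π ≥ 1`
  obtain ⟨π, hπdef⟩ : ∃ π : Polynomial k, π = minpoly k (ρ (X 1)) := ⟨_, rfl⟩
  rw [← hπdef] at hhdeg
  have hπprime : Prime π := hπdef ▸ (minpoly.irreducible (hint 1)).prime
  have hπroot : Polynomial.aeval (ρ (X 1)) π = 0 := hπdef ▸ minpoly.aeval k _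
  have hdvd' : ∀ q : Polynomial k, Polynomial.aeval (ρ (X 1)) q = 0 → π ∣ q :=
    fun q hq => hπdef ▸ minpoly.dvd k _ hq
  -- `ev″ : T_1 ↦ h(X), T_2 ↦ X`, with `ρ = (X ↦ t_2) ∘ ev″` and `ker ev″ = (ℓ̃)`
  obtain ⟨ev, hevdef⟩ : ∃ ev : MvPolynomial (Fin 2) k →ₐ[k] Polynomial k,
      ev = MvPolynomial.aeval ![h, Polynomial.X] := ⟨_, rfl⟩
  have hcomp : ∀ p, Polynomial.aeval (ρ (X 1)) (ev p) = ρ p := by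
    intro p
    have : (Polynomial.aeval (ρ (X 1)) : Polynomial k →ₐ[k] K).comp ev = ρ := by
      rw [hevdef]
      refine MvPolynomial.algHom_ext fun i => ?_
      fin_cases i
      · simp [hh]
      · simp
    exact AlgHom.congr_fun this p
  obtain ⟨ℓ, hℓdef⟩ : ∃ ℓ : MvPolynomial (Fin 2) k, ℓ = X 0 - h.toMvPolynomial 1 := ⟨_, rfl⟩
  have hker : RingHom.ker ev = Ideal.span {ℓ} := by
    rw [hevdef, hℓdef]; exact ker_aeval_vecCons_X k h
  obtain ⟨πM, hπMdef⟩ : ∃ πM : MvPolynomial (Fin 2) k, πM = π.toMvPolynomial 1 := ⟨_, rfl⟩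
  have hevr : ∀ r : Polynomial k, ev (r.toMvPolynomial 1) = r := fun r => by
    rw [hevdef, MvPolynomial.aeval_toMvPolynomial]
    exact Polynomial.aeval_X_left_apply r
  have hevπM : ev πM = π := by rw [hπMdef]; exact hevr π
  have hevC : ∀ c : k, ev (MvPolynomial.C c) = Polynomial.C c := fun c => by
    rw [hevdef, MvPolynomial.algHom_C, Polynomial.algebraMap_apply, Algebra.algebraMap_self,
      RingHom.id_apply]
  have hℓev : ev ℓ = 0 := by rw [← RingHom.mem_ker, hker]; exact Ideal.mem_span_singleton_self ℓ
  have hℓρ : ℓ ∈ RingHom.ker ρ := by rw [RingHom.mem_ker, ← hcomp, hℓev, map_zero]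
  have hπMρ : πM ∈ RingHom.ker ρ := by rw [RingHom.mem_ker, ← hcomp, hevπM, hπroot]
  have hℓ0 : ℓ ≠ 0 := by
    intro h0
    have := congr_arg (planeEquiv k) h0
    rw [hℓdef, map_sub, planeEquiv_X_zero, planeEquiv_toMvPolynomial, map_zero] at this
    exact Polynomial.X_sub_C_ne_zero h this
  have hℓprime : (Ideal.span {ℓ}).IsPrime := hker ▸ RingHom.ker_isPrime ev
  have hπMℓ : πM ∉ Ideal.span {ℓ} := by
    rw [← hker, RingHom.mem_ker, hevπM]
    exact hπprime.ne_zero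
  -- `ker ρ = (ℓ̃, π(T_2))`
  have hdvd : ∀ p ∈ RingHom.ker ρ, π ∣ ev p := fun p hp =>
    hdvd' _ (by rw [hcomp]; exact hp)
  have h𝔮 : RingHom.ker ρ = Ideal.span {ℓ, πM} := by
    refine le_antisymm (fun p hp => ?_) ?_
    · obtain ⟨r, hr⟩ := hdvd p hp
      have hmem : p - r.toMvPolynomial 1 * πM ∈ Ideal.span {ℓ} := by
        rw [← hker, RingHom.mem_ker, map_sub, map_mul, hevπM, hevr, hr, mul_comm, sub_self]
      obtain ⟨u, hu⟩ := Ideal.mem_span_singleton'.mp hmem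
      exact Ideal.mem_span_pair.mpr ⟨u, r.toMvPolynomial 1, by rw [hu]; ring⟩
    · rw [Ideal.span_le]
      rintro x (rfl | rfl)
      · exact hℓρ
      · exact hπMρ
  -- `π^{n+1} ∣ ev″ g`, and `ev″ g = c π^{n+1}` with `c = 0` unless `d = 1`
  have hπs : ¬π ∣ ev s := fun hd => hs (by
    rw [RingHom.mem_ker, ← hcomp]
    exact Polynomial.aeval_eq_zero_of_dvd_aeval_eq_zero hd hπroot)
  have hπg : π ^ (n + 1) ∣ ev g := hπprime.pow_dvd_of_dvd_mul_left (n + 1) hπs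
    (by rw [← map_mul]; exact pow_dvd_of_mem_ker_pow ρ ev π hdvd hsg)
  have hevdeg : (ev g).natDegree ≤ max 1 (π.natDegree - 1) * g.totalDegree := by
    rw [hevdef]
    refine natDegree_aeval_le_mul_totalDegree k _ (fun i => ?_) g
    fin_cases i
    · change h.natDegree ≤ _; omega
    · change (Polynomial.X : Polynomial k).natDegree ≤ _
      rw [Polynomial.natDegree_X]; exact le_max_left _ _
  obtain ⟨c, hc, hcd⟩ : ∃ c : k, ev g = Polynomial.C c * π ^ (n + 1) ∧
      (2 ≤ π.natDegree → c = 0) := by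
    by_cases hz : ev g = 0
    · exact ⟨0, by rw [hz, map_zero, zero_mul], fun _ => rfl⟩
    obtain ⟨r, hr⟩ := hπg
    have hr0 : r ≠ 0 := fun h0 => hz (by rw [hr, h0, mul_zero])
    have hdegeq : (ev g).natDegree = (n + 1) * π.natDegree + r.natDegree := by
      rw [hr, Polynomial.natDegree_mul (pow_ne_zero _ hπprime.ne_zero) hr0,
        Polynomial.natDegree_pow]
    have h1 : (n + 1) * π.natDegree ≤ (n + 1) * max 1 (π.natDegree - 1) := by
      calc (n + 1) * π.natDegree ≤ (ev g).natDegree := by rw [hdegeq]; exact Nat.le_add_right _ _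
        _ ≤ max 1 (π.natDegree - 1) * (n + 1) := hevdeg.trans (Nat.mul_le_mul_left _ hdeg)
        _ = (n + 1) * max 1 (π.natDegree - 1) := mul_comm _ _
    have hd1 : π.natDegree = 1 := by
      have := Nat.le_of_mul_le_mul_left h1 (Nat.succ_pos n)
      omega
    have hr1 : r.natDegree = 0 := by
      have h2 : (ev g).natDegree ≤ n + 1 := by
        refine hevdeg.trans ?_
        rw [hd1]; simpa using hdeg
      rw [hdegeq, hd1] at h2
      omega
    refine ⟨r.coeff 0, ?_, fun h2 => by omega⟩
    rw [hr, mul_comm]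
    congr 1
    exact Polynomial.eq_C_of_natDegree_eq_zero hr1
  -- the `π(T_2)`-part lies in `U′^{n+1}` and has degree `≤ n + 1`
  have hπMdeg_of : c ≠ 0 → πM.totalDegree ≤ 1 := fun hc0 => by
    have hd1 : π.natDegree = 1 := by
      have hd : 1 ≤ π.natDegree := hπdef ▸ minpoly.natDegree_pos (hint 1)
      by_contra hne; exact hc0 (hcd (by omega))
    rw [hπMdef]
    exact (totalDegree_toMvPolynomial_le' k π 1).trans hd1.le
  have hπMpart : MvPolynomial.C c * πM ^ (n + 1) ∈ affineLinearIn (RingHom.ker ρ) ^ (n + 1) := by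
    by_cases hc0 : c = 0
    · rw [hc0, map_zero, zero_mul]; exact Submodule.zero_mem _
    exact C_mul_pow_mem_affineLinearIn_pow
      (mem_affineLinearIn_iff.mpr ⟨hπMdeg_of hc0, hπMρ⟩) c (n + 1)
  have hπMpartdeg : (MvPolynomial.C c * πM ^ (n + 1)).totalDegree ≤ n + 1 := by
    by_cases hc0 : c = 0
    · rw [hc0, map_zero, zero_mul, MvPolynomial.totalDegree_zero]; exact Nat.zero_le _
    refine (MvPolynomial.totalDegree_mul _ _).trans ?_
    rw [MvPolynomial.totalDegree_C, zero_add]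
    refine (MvPolynomial.totalDegree_pow _ _).trans ?_
    calc (n + 1) * πM.totalDegree ≤ (n + 1) * 1 := Nat.mul_le_mul_left _ (hπMdeg_of hc0)
      _ = n + 1 := mul_one _
  -- `g - c π(T_2)^{n+1} = g₂ ℓ̃`
  have hgker : g - MvPolynomial.C c * πM ^ (n + 1) ∈ Ideal.span {ℓ} := by
    rw [← hker, RingHom.mem_ker, map_sub, map_mul, map_pow, hevπM, hevC, hc, sub_self]
  obtain ⟨g₂, hg₂⟩ := Ideal.mem_span_singleton'.mp hgker
  have hgeq : g = g₂ * ℓ + MvPolynomial.C c * πM ^ (n + 1) := by rw [hg₂]; ring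
  -- cancellation: `s g₂ ∈ 𝔮^n`
  have hsg₂ : s * g₂ ∈ RingHom.ker ρ ^ n := by
    have hmem : ℓ * (s * g₂) ∈ RingHom.ker ρ ^ (n + 1) := by
      have : ℓ * (s * g₂) = s * g - s * (MvPolynomial.C c * πM ^ (n + 1)) := by rw [hgeq]; ring
      rw [this]
      exact Ideal.sub_mem _ hsg (Ideal.mul_mem_left _ _ (Ideal.mul_mem_left _ _
        (Ideal.pow_mem_pow hπMρ _)))
    rw [h𝔮] at hmem ⊢
    exact mem_span_pair_pow_of_mul_mem hℓprime hπMℓ hℓ0 hmem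
  -- degrees, induction hypothesis, conclusion
  by_cases hg₂0 : g₂ = 0
  · rw [hgeq, hg₂0, zero_mul, zero_add]; exact hπMpart
  have hℓdeg1 : 1 ≤ ℓ.totalDegree := by
    by_contra hlt
    rw [not_le, Nat.lt_one_iff, MvPolynomial.totalDegree_eq_zero_iff_eq_C] at hlt
    apply hℓ0
    have h1 := hℓev
    rw [hlt, hevC, Polynomial.C_eq_zero] at h1
    rw [hlt, h1, map_zero]
  have hprod : (g₂ * ℓ).totalDegree = g₂.totalDegree + ℓ.totalDegree :=
    MvPolynomial.totalDegree_mul_of_isDomain hg₂0 hℓ0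
  have hprod_le : (g₂ * ℓ).totalDegree ≤ n + 1 := by
    rw [hg₂]
    exact (MvPolynomial.totalDegree_sub _ _).trans (max_le hdeg hπMpartdeg)
  have hg₂deg : g₂.totalDegree ≤ n := by omega
  have hg₂mem : g₂ ∈ affineLinearIn (RingHom.ker ρ) ^ n := ih g₂ hg₂deg hsg₂
  have hg₂ord : n ≤ g₂.totalDegree :=
    le_totalDegree_of_mul_mem_pow k (RingHom.ker ρ) hs hsg₂ hg₂0
  have hℓU : ℓ ∈ affineLinearIn (RingHom.ker ρ) :=
    mem_affineLinearIn_iff.mpr ⟨by omega, hℓρ⟩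
  rw [hgeq]
  exact Submodule.add_mem _ (mul_mem_affineLinearIn_pow_succ hg₂mem hℓU) hπMpart

/-- **Inductive step, case `t_1 ∉ k(t_2)`** (`k′ = k(t_2)` any model: a field through which
`k[X] → K, X ↦ t_2` factors surjectively; the hypothesis is `deg minpoly_{k′}(t_1) ≥ 2`): see the
module docstring. [cite: CossartPiltant2008, Lemma 4.3; Hironaka1970, Thm. 2] -/
theorem mem_affineLinearIn_pow_succ_of_two_le {k' : Type*} [Field k'] [Algebra k k'] [Algebra k' K]
    [IsScalarTower k k' K] (t₂ : k') (ht₂ : algebraMap k' K t₂ = ρ (X 1))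
    (hsurjφ : Function.Surjective (Polynomial.aeval t₂ : Polynomial k →ₐ[k] k'))
    (hint : ∀ i, IsIntegral k (ρ (X i))) (hM : 2 ≤ (minpoly k' (ρ (X 0))).natDegree)
    {s : MvPolynomial (Fin 2) k} (hs : s ∉ RingHom.ker ρ) {n : ℕ}
    (ih : ∀ g : MvPolynomial (Fin 2) k, g.totalDegree ≤ n → s * g ∈ RingHom.ker ρ ^ n →
      g ∈ affineLinearIn (RingHom.ker ρ) ^ n)
    {g : MvPolynomial (Fin 2) k} (hdeg : g.totalDegree ≤ n + 1)
    (hsg : s * g ∈ RingHom.ker ρ ^ (n + 1)) :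
    g ∈ affineLinearIn (RingHom.ker ρ) ^ (n + 1) := by
  classical
  haveI : (RingHom.ker ρ).IsPrime := RingHom.ker_isPrime ρ
  -- `ev′ : T_1 ↦ X, T_2 ↦ t_2`, `ρ = (X ↦ t_1) ∘ ev′`, `ker ev′ = (π(T_2))`, `ev′` onto
  obtain ⟨ev, hevdef⟩ : ∃ ev : MvPolynomial (Fin 2) k →ₐ[k] Polynomial k',
      ev = MvPolynomial.aeval ![Polynomial.X, Polynomial.C t₂] := ⟨_, rfl⟩
  have hcomp : ∀ p, Polynomial.aeval (ρ (X 0)) (ev p) = ρ p := by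
    intro p
    have : ((Polynomial.aeval (ρ (X 0)) : Polynomial k' →ₐ[k'] K).restrictScalars k).comp ev = ρ := by
      rw [hevdef]
      refine MvPolynomial.algHom_ext fun i => ?_
      fin_cases i
      · simp
      · simp [ht₂]
    exact AlgHom.congr_fun this p
  obtain ⟨πM, hπMdef⟩ : ∃ πM : MvPolynomial (Fin 2) k,
      πM = (minpoly k (ρ (X 1))).toMvPolynomial 1 := ⟨_, rfl⟩
  have hminpoly : minpoly k t₂ = minpoly k (ρ (X 1)) := by
    rw [← ht₂]; exact (minpoly.algebraMap_eq (algebraMap k' K).injective t₂).symm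
  have hker : RingHom.ker ev = Ideal.span {πM} := by
    rw [hevdef, ker_aeval_vecCons_C, hminpoly, hπMdef]
  have hsurj : Function.Surjective ev := by
    intro q
    obtain ⟨q', hq'⟩ := Polynomial.map_surjective
      (Polynomial.aeval t₂ : Polynomial k →ₐ[k] k').toRingHom hsurjφ q
    refine ⟨(planeEquiv k).symm q', ?_⟩
    rw [hevdef, aeval_vecCons_C_eq, AlgEquiv.apply_symm_apply, hq']
  -- `ψ`, the minimal polynomial of `t_1` over `k′`: degree `≥ 2`
  obtain ⟨ψ, hψdef⟩ : ∃ ψ : Polynomial k', ψ = minpoly k' (ρ (X 0)) := ⟨_, rfl⟩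
  rw [← hψdef] at hM
  have hint0 : IsIntegral k' (ρ (X 0)) := (hint 0).tower_top
  have hψprime : Prime ψ := hψdef ▸ (minpoly.irreducible hint0).prime
  have hψroot : Polynomial.aeval (ρ (X 0)) ψ = 0 := hψdef ▸ minpoly.aeval k' _
  have hdvd : ∀ p ∈ RingHom.ker ρ, ψ ∣ ev p := fun p hp =>
    hψdef ▸ minpoly.dvd k' _ (by rw [hcomp]; exact hp)
  have hψs : ¬ψ ∣ ev s := fun hd => hs (by
    rw [RingHom.mem_ker, ← hcomp]
    exact Polynomial.aeval_eq_zero_of_dvd_aeval_eq_zero hd hψroot)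
  have hψg : ψ ^ (n + 1) ∣ ev g := hψprime.pow_dvd_of_dvd_mul_left (n + 1) hψs
    (by rw [← map_mul]; exact pow_dvd_of_mem_ker_pow ρ ev ψ hdvd hsg)
  -- hence `ev′ g = 0`, `g = g₁ π(T_2)`
  have hevg : ev g = 0 := by
    by_contra hne
    have h1 : (n + 1) * ψ.natDegree ≤ (ev g).natDegree := by
      rw [← Polynomial.natDegree_pow]; exact Polynomial.natDegree_le_of_dvd hψg hne
    have h2 : (ev g).natDegree ≤ 1 * g.totalDegree := by
      rw [hevdef]
      refine natDegree_aeval_le_mul_totalDegree k _ (fun i => ?_) g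
      fin_cases i
      · change (Polynomial.X : Polynomial k').natDegree ≤ 1
        rw [Polynomial.natDegree_X]
      · change (Polynomial.C t₂).natDegree ≤ 1
        rw [Polynomial.natDegree_C]; exact Nat.zero_le _
    have h3 : (n + 1) * ψ.natDegree ≤ (n + 1) * 1 := by
      rw [mul_one]; exact h1.trans (h2.trans (by rw [one_mul]; exact hdeg))
    have := Nat.le_of_mul_le_mul_left h3 (Nat.succ_pos n)
    omega
  have hgker : g ∈ Ideal.span {πM} := by rw [← hker, RingHom.mem_ker]; exact hevg
  obtain ⟨g₁, hg₁⟩ := Ideal.mem_span_singleton'.mp hgker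
  -- `ker ρ = (π(T_2), b)` with `ev′ b = ψ`
  obtain ⟨b, hb⟩ := hsurj ψ
  have hπMρ : πM ∈ RingHom.ker ρ := by
    rw [RingHom.mem_ker, hπMdef, apply_toMvPolynomial]
    exact minpoly.aeval k _
  have hbρ : b ∈ RingHom.ker ρ := by
    rw [RingHom.mem_ker, ← hcomp, hb, hψroot]
  have h𝔮 : RingHom.ker ρ = Ideal.span {πM, b} := by
    refine le_antisymm (fun p hp => ?_) ?_
    · obtain ⟨r, hr⟩ := hdvd p hp
      obtain ⟨r', hr'⟩ := hsurj r
      have hmem : p - r' * b ∈ Ideal.span {πM} := by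
        rw [← hker, RingHom.mem_ker, map_sub, map_mul, hr', hb, hr, mul_comm, sub_self]
      obtain ⟨u, hu⟩ := Ideal.mem_span_singleton'.mp hmem
      exact Ideal.mem_span_pair.mpr ⟨u, r', by rw [hu]; ring⟩
    · rw [Ideal.span_le]
      rintro x (rfl | rfl)
      · exact hπMρ
      · exact hbρ
  have hπMprime : (Ideal.span {πM}).IsPrime := hker ▸ RingHom.ker_isPrime ev
  have hbπM : b ∉ Ideal.span {πM} := by
    rw [← hker, RingHom.mem_ker, hb]
    exact hψprime.ne_zero
  have hπM0 : πM ≠ 0 := by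
    rw [hπMdef]
    exact fun h0 => minpoly.ne_zero (hint 1)
      (Polynomial.toMvPolynomial_injective (1 : Fin 2) (by rw [h0, map_zero]))
  -- cancellation and degrees
  have hsg₁ : s * g₁ ∈ RingHom.ker ρ ^ n := by
    have hmem : πM * (s * g₁) ∈ RingHom.ker ρ ^ (n + 1) := by
      have : πM * (s * g₁) = s * g := by rw [← hg₁]; ring
      rw [this]; exact hsg
    rw [h𝔮] at hmem ⊢
    exact mem_span_pair_pow_of_mul_mem hπMprime hbπM hπM0 hmem
  by_cases hg₁0 : g₁ = 0
  · rw [← hg₁, hg₁0, zero_mul]; exact Submodule.zero_mem _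
  have hπMdeg1 : 1 ≤ πM.totalDegree := by
    by_contra hlt
    rw [not_le, Nat.lt_one_iff, MvPolynomial.totalDegree_eq_zero_iff_eq_C] at hlt
    apply hπM0
    have h1 : ev πM = 0 := by
      rw [← RingHom.mem_ker, hker]; exact Ideal.mem_span_singleton_self _
    rw [hlt, MvPolynomial.algHom_C, Polynomial.algebraMap_apply, Polynomial.C_eq_zero,
      map_eq_zero] at h1
    rw [hlt, h1, map_zero]
  have hprod : (g₁ * πM).totalDegree = g₁.totalDegree + πM.totalDegree :=
    MvPolynomial.totalDegree_mul_of_isDomain hg₁0 hπM0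
  rw [hg₁] at hprod
  have hg₁deg : g₁.totalDegree ≤ n := by omega
  have hg₁mem : g₁ ∈ affineLinearIn (RingHom.ker ρ) ^ n := ih g₁ hg₁deg hsg₁
  have hg₁ord : n ≤ g₁.totalDegree :=
    le_totalDegree_of_mul_mem_pow k (RingHom.ker ρ) hs hsg₁ hg₁0
  have hπMU : πM ∈ affineLinearIn (RingHom.ker ρ) :=
    mem_affineLinearIn_iff.mpr ⟨by omega, hπMρ⟩
  rw [← hg₁]
  exact mul_mem_affineLinearIn_pow_succ hg₁mem hπMU

/-- **The closed point case**: for `𝔮 = ker ρ` with `k[T_1, T_2]/𝔮` algebraic over `k`, every `g`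
with `deg g ≤ n` and `s g ∈ 𝔮^n` (`s ∉ 𝔮`) lies in `U′(𝔮)^n`.
[cite: CossartPiltant2008, Lemma 4.3; Hironaka1970, Thm. 2] -/
theorem mem_affineLinearIn_pow_of_isIntegral (hint : ∀ i, IsIntegral k (ρ (X i)))
    {s : MvPolynomial (Fin 2) k} (hs : s ∉ RingHom.ker ρ) (n : ℕ) :
    ∀ g : MvPolynomial (Fin 2) k, g.totalDegree ≤ n → s * g ∈ RingHom.ker ρ ^ n →
      g ∈ affineLinearIn (RingHom.ker ρ) ^ n := by
  induction n with
  | zero => exact fun g hg _ => mem_affineLinearIn_pow_zero _ hg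
  | succ n ih =>
    intro g hdeg hsg
    by_cases hM : ρ (X 0) ∈ (algebraMap (IntermediateField.adjoin k {ρ (X 1)}) K).range
    · obtain ⟨y, hy⟩ := hM
      obtain ⟨h, hh, hhdeg⟩ := exists_aeval_eq_of_mem_adjoin_simple (hint 1) y.2
      exact mem_affineLinearIn_pow_succ_of_aeval_eq ρ hint (hh.trans hy) hhdeg hs ih hdeg hsg
    · have hint0 : IsIntegral (IntermediateField.adjoin k {ρ (X 1)}) (ρ (X 0)) :=
        (hint 0).tower_top
      exact mem_affineLinearIn_pow_succ_of_two_le ρ (IntermediateField.AdjoinSimple.gen k (ρ (X 1)))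
        (IntermediateField.AdjoinSimple.algebraMap_gen k (ρ (X 1))) (aeval_gen_surjective (hint 1))
        hint ((minpoly.two_le_natDegree_iff hint0).mpr hM) hs ih hdeg hsg

end ClosedPoint

/-! ## The theorem -/

/-- **Near points of the plane lie on rational lines (Hironaka's Theorem 2 for `ℙ²`, affine
chart form).** Let `𝔮` be any prime of `k[T_1, T_2]` (`k` any field), `μ ≥ 0`, and `g` a
polynomial of degree `≤ μ` with `s g ∈ 𝔮^μ` for some `s ∉ 𝔮` (i.e. `ord_𝔮 g ≥ μ`). Then `g` is
a `k`-linear combination of products of `μ` affine-linear polynomials lying in `𝔮`: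
`g ∈ U′(𝔮)^μ`. In particular `g = 0` unless `𝔮` contains a `k`-rational line.
[cite: Hironaka1970, Thm. 2; CossartPiltant2008, proof of Prop. 4.2, "By Hironaka's theorem 2 [25],
x′ ∈ Proj(Dir_x(E))", p. 8] -/
theorem mem_affineLinearIn_pow_of_mul_mem_pow (𝔮 : Ideal (MvPolynomial (Fin 2) k)) [𝔮.IsPrime]
    {μ : ℕ} {s g : MvPolynomial (Fin 2) k} (hs : s ∉ 𝔮) (hsg : s * g ∈ 𝔮 ^ μ)
    (hdeg : g.totalDegree ≤ μ) : g ∈ affineLinearIn 𝔮 ^ μ := by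
  classical
  rcases eq_bot_or_eq_span_or_isMaximal k 𝔮 with h0 | ⟨π, hπ, hπ𝔮⟩ | hmax
  · -- the generic point
    subst h0
    cases μ with
    | zero => exact mem_affineLinearIn_pow_zero _ hdeg
    | succ n =>
      have hs0 : s ≠ 0 := fun h => hs (by rw [h]; exact Ideal.zero_mem _)
      have : s * g = 0 := by
        have h := Ideal.pow_le_self (Nat.succ_ne_zero n) hsg
        rwa [Ideal.mem_bot] at h
      rcases mul_eq_zero.mp this with h | h
      · exact absurd h hs0
      · rw [h]; exact Submodule.zero_mem _
  · -- a curve `(π)`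
    subst hπ𝔮
    have hπs : ¬π ∣ s := fun h => hs (Ideal.mem_span_singleton.mpr h)
    have hπg : π ^ μ ∣ g := by
      refine hπ.pow_dvd_of_dvd_mul_left μ hπs ?_
      rw [← Ideal.mem_span_singleton, ← Ideal.span_singleton_pow]
      exact hsg
    cases μ with
    | zero => exact mem_affineLinearIn_pow_zero _ hdeg
    | succ n =>
      by_cases hg0 : g = 0
      · rw [hg0]; exact Submodule.zero_mem _
      obtain ⟨r, hr⟩ := hπg
      have hr0 : r ≠ 0 := fun h => hg0 (by rw [hr, h, mul_zero])
      have hπ0 : π ≠ 0 := hπ.ne_zero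
      have hπdeg1 : 1 ≤ π.totalDegree := by
        by_contra hlt
        rw [not_le, Nat.lt_one_iff, MvPolynomial.totalDegree_eq_zero_iff_eq_C] at hlt
        refine hπ.not_unit ?_
        rw [hlt]
        refine (isUnit_iff_ne_zero.mpr fun h0 => hπ0 ?_).map MvPolynomial.C
        rw [hlt, h0, map_zero]
      have hdegeq : g.totalDegree = (n + 1) * π.totalDegree + r.totalDegree := by
        rw [hr, MvPolynomial.totalDegree_mul_of_isDomain (pow_ne_zero _ hπ0) hr0,
          totalDegree_pow_of_isDomain k hπ0]
      have hπdeg : π.totalDegree = 1 := by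
        have h1 : (n + 1) * π.totalDegree ≤ (n + 1) * 1 := by
          rw [mul_one]
          calc (n + 1) * π.totalDegree ≤ g.totalDegree := by rw [hdegeq]; exact Nat.le_add_right _ _
            _ ≤ n + 1 := hdeg
        have := Nat.le_of_mul_le_mul_left h1 (Nat.succ_pos n)
        omega
      have hrdeg : r.totalDegree = 0 := by
        rw [hdegeq, hπdeg] at hdeg
        omega
      have hπU : π ∈ affineLinearIn (Ideal.span {π}) :=
        mem_affineLinearIn_iff.mpr ⟨hπdeg.le, Ideal.mem_span_singleton_self π⟩
      rw [hr, MvPolynomial.totalDegree_eq_zero_iff_eq_C.mp hrdeg, mul_comm]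
      exact C_mul_pow_mem_affineLinearIn_pow hπU _ _
  · -- a closed point
    haveI := hmax
    letI : Field (MvPolynomial (Fin 2) k ⧸ 𝔮) := Ideal.Quotient.field 𝔮
    have hker : RingHom.ker (Ideal.Quotient.mkₐ k 𝔮) = 𝔮 := Ideal.Quotient.mkₐ_ker k 𝔮
    have hint : ∀ i, IsIntegral k (Ideal.Quotient.mkₐ k 𝔮 (X i : MvPolynomial (Fin 2) k)) :=
      fun i => isIntegral_quotient_mk_X k 𝔮 i
    rw [← hker] at hs hsg ⊢
    exact mem_affineLinearIn_pow_of_isIntegral (Ideal.Quotient.mkₐ k 𝔮) hint hs μ g hdeg hsg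

end Literature.AlgebraicGeometry.Resolution

end
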